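import Summits.QuantumAdvantage.QuantumAdvantage.Theorems.WalkThreeStepSymmetry
import Summits.QuantumAdvantage.QuantumAdvantage.Theorems.WalkSwapConnect

/-!
# Rung (G♯₂) `ThreeStepFreeRungFive` (item stmt-QuantumAdvantage-23286), architecture (U), module U-d 5/5: the THREE-WEIGHTS LAW
# (ROUND-27 §3.6–3.7)

Cell qa-qnc0, route OddPrimeWalk, support item stmt-QuantumAdvantage-23286 (planner qa-qnc0-p2 g27, sketch `RungUSketch.lean`
module `ThreeWeights`); prover qn-prover-3 g16.

**`threeWeights_law`**: on an interval `[a, a+L)` of degenerate positions where every cut is R-local or block-blind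
(`LocalOrBlind`, 2/5), for every outside assignment `u`, offset `C` and weight `v` with room (`C + v + 3p + 2R ≤ L`,
`a + L + 2R + 4(2p−1) ≤ n`), the three block inputs `fillBlock u a L C v`, `… (v + p)`, `… (v + 2p)` (the sketch's `fillBlock`: the
bits of `[a, a+L)` replaced by `0^C 1^w 0^…`) do NOT all win (`3 ∤ p`; for `p = 5` the weights `v, v+5, v+10` of the sketch).
Proof: by the symmetry of 3/5 and `swap_connect` (4/5) the register of the block of weight `w + p` equals that of the TWO-BLOCK input
"block `w` ∪ `p` ones at the common far position `b⋆ = a + C + v + p + 2R`"; §3 INCREMENT HOMOGENEITY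
`Ŵ(v+2p) + Ŵ(v+p) = ζ^p (Ŵ(v+p) + Ŵ(v))` by splitting the register at `b⋆ − R` (left terms cancel, right terms are relabelled by `ζ^p`,
`term_shift`) — the (FE) step of ROUND-27 §3.6 at fixed `W mod p`; §4 the trace computation
`Σ_k Tr(ζ^{t₀+kp}(A₀ + …))`: the three values cannot all be `1` (`not_three_ones`, `decide` in `F4`).
RE-CUT NOTE: the hypothesis is the prover's `LocalOrBlind` (per-cut window around its own position, or block-blind), not the sketch's
`LocalModW S g (a−R) (a+L+R)`; the assembly (module U-c) has to deliver this form.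
WHAT THIS IS NOT: not the item (U-c, U-e, U-f remain); separation NOT moved.
-/

namespace Summit.QuantumAdvantage.AdviceFreeQNC0.LocalEngine

open Finset Classical

namespace RungU

variable {p n : ℕ}

/-! ### §2 Block inputs -/

/-- The input `u` with the bits of `[a, a+L)` replaced by the block `1^v` placed at `a + C` (the sketch's `fillBlock`). -/
def fillBlock (u : Fin n → Bool) (a L C v : ℕ) : Fin n → Bool :=
  fun i => if a ≤ i.val ∧ i.val < a + L then decide (a + C ≤ i.val ∧ i.val < a + C + v) else u i

/-- the index segment `[lo, lo + len)`. -/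
noncomputable def seg (lo len : ℕ) : Finset (Fin n) := univ.filter fun i : Fin n => lo ≤ i.val ∧ i.val < lo + len

/-- membership in a segment. -/
theorem mem_seg {lo len : ℕ} {i : Fin n} : i ∈ (seg lo len : Finset (Fin n)) ↔ lo ≤ i.val ∧ i.val < lo + len := by
  unfold seg; simp

/-- number of segment indices below `r`: none below `lo` … -/
theorem card_seg_filter_of_le {lo len r : ℕ} (hr : r ≤ lo) : ((seg lo len : Finset (Fin n)).filter fun i => i.val < r).card = 0 := by
  rw [Finset.card_eq_zero, Finset.filter_eq_empty_iff]
  intro i hi h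
  rw [mem_seg] at hi
  omega

/-- … and all `len` of them beyond `lo + len ≤ n`. -/
theorem card_seg_filter_of_ge {lo len r : ℕ} (hn : lo + len ≤ n) (hr : lo + len ≤ r) :
    ((seg lo len : Finset (Fin n)).filter fun i => i.val < r).card = len := by
  have e : ((seg lo len : Finset (Fin n)).filter fun i => i.val < r) = seg lo len := by
    apply Finset.filter_true_of_mem; intro i hi; rw [mem_seg] at hi; omega
  rw [e]
  have himg : (seg lo len : Finset (Fin n)).image Fin.val = Finset.Ico lo (lo + len) := by
    ext y
    simp only [Finset.mem_image, mem_seg, Finset.mem_Ico]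
    constructor
    · rintro ⟨i, ⟨h1, h2⟩, rfl⟩; exact ⟨h1, h2⟩
    · rintro ⟨h1, h2⟩; exact ⟨⟨y, by omega⟩, ⟨h1, h2⟩, rfl⟩
  rw [← Finset.card_image_of_injective _ Fin.val_injective, himg, Nat.card_Ico]
  omega

/-- growing the block by `q` ones = flipping the next segment. -/
theorem fillBlock_add (u : Fin n → Bool) (a L C v q : ℕ) (h : C + v + q ≤ L) :
    fillBlock u a L C (v + q) = flipOn (seg (a + C + v) q) (fillBlock u a L C v) := by
  funext i
  by_cases hi : i ∈ (seg (a + C + v) q : Finset (Fin n))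
  · rw [flipOn_of_mem hi]
    rw [mem_seg] at hi
    unfold fillBlock
    rw [if_pos (by omega), if_pos (by omega)]
    rw [decide_eq_true (by omega), decide_eq_false (by omega)]
    rfl
  · rw [flipOn_of_not_mem hi]
    rw [mem_seg] at hi
    unfold fillBlock
    by_cases hin : a ≤ i.val ∧ i.val < a + L
    · rw [if_pos hin, if_pos hin]
      by_cases h1 : a + C ≤ i.val ∧ i.val < a + C + v
      · rw [decide_eq_true h1, decide_eq_true (by omega)]
      · rw [decide_eq_false h1, decide_eq_false (by omega)]
    · rw [if_neg hin, if_neg hin]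

/-- the block input is `false` on the block region beyond its ones. -/
theorem fillBlock_false (u : Fin n → Bool) {a L C v : ℕ} (i : Fin n) (h1 : a + C + v ≤ i.val) (h2 : i.val < a + L) :
    fillBlock u a L C v i = false := by
  unfold fillBlock
  rw [if_pos (by omega), decide_eq_false (by omega)]

/-- block inputs agree with `u` outside `[a, a+L)`. -/
theorem fillBlock_outside (u : Fin n → Bool) {a L C v : ℕ} (i : Fin n) (h : ¬ (a ≤ i.val ∧ i.val < a + L)) :
    fillBlock u a L C v i = u i := by
  unfold fillBlock; rw [if_neg h]

/-- the count of a flipped-in segment of zeros. -/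
theorem cnt_flipOn_seg (x : Fin n → Bool) {a L lo len : ℕ} (hlo : a ≤ lo) (hhi : lo + len ≤ a + L) (hn : a + L ≤ n)
    (hx : ∀ i ∈ (seg lo len : Finset (Fin n)), x i = false) : cnt (flipOn (seg lo len) x) a (a + L) = cnt x a (a + L) + len := by
  have e1 := card_band_eq x (Nat.le_add_right a L)
  have e2 := card_band_eq (flipOn (seg lo len) x) (Nat.le_add_right a L)
  have e3 := wtPrefix_flipOn_false (seg lo len) x hx a
  have e4 := wtPrefix_flipOn_false (seg lo len) x hx (a + L)
  rw [card_seg_filter_of_le hlo] at e3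
  rw [card_seg_filter_of_ge (by omega) hhi] at e4
  unfold cnt
  omega

/-! ### §3 Increment homogeneity -/

section Increment

variable (S : ThreeStep p n) {a L R C v : ℕ} (u : Fin n → Bool)

/-- **INCREMENT HOMOGENEITY** (the (FE) step of ROUND-27 §3.6 at fixed `W mod p`): with `B_w` the block input of weight `w` and
`T_w := B_w` plus `p` ones at the common far position `b⋆ = a + C + v + p + 2R`,
`Ŵ(T_{v+p}) + Ŵ(B_{v+p}) = ζ^p · (Ŵ(T_v) + Ŵ(B_v))`. -/
theorem increment_homog (hLB : LocalOrBlind S a L R) (hL : C + v + 3 * p + 2 * R ≤ L) (hn : a + L ≤ n) :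
    reg S (flipOn (seg (a + C + v + p + 2 * R) p) (fillBlock u a L C (v + p))) + reg S (fillBlock u a L C (v + p))
      = rotZ ((p : ℕ) : ZMod 3)
          (reg S (flipOn (seg (a + C + v + p + 2 * R) p) (fillBlock u a L C v)) + reg S (fillBlock u a L C v)) := by
  set b := a + C + v + p + 2 * R with hb
  set B0 := fillBlock u a L C v with hB0
  set B1 := fillBlock u a L C (v + p) with hB1
  set F1 : Finset (Fin n) := seg (a + C + v) p with hF1
  set Fs : Finset (Fin n) := seg b p with hFs
  have hB1e : B1 = flipOn F1 B0 := by rw [hB1, hB0, hF1]; exact fillBlock_add u a L C v p (by omega)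
  -- zeros under the flipped segments
  have zB0F1 : ∀ i ∈ F1, B0 i = false := fun i hi => by
    rw [hF1, mem_seg] at hi; exact fillBlock_false u i (by omega) (by omega)
  have zB0Fs : ∀ i ∈ Fs, B0 i = false := fun i hi => by
    rw [hFs, mem_seg] at hi; exact fillBlock_false u i (by omega) (by omega)
  have zB1Fs : ∀ i ∈ Fs, B1 i = false := fun i hi => by
    rw [hFs, mem_seg] at hi; exact fillBlock_false u i (by omega) (by omega)
  have zT0F1 : ∀ i ∈ F1, flipOn Fs B0 i = false := fun i hi => by
    have hi' := hi
    rw [hF1, mem_seg] at hi'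
    rw [flipOn_of_not_mem (fun h => by rw [hFs, mem_seg] at h; omega)]
    exact zB0F1 i hi
  have hT1e : flipOn Fs B1 = flipOn F1 (flipOn Fs B0) := by
    rw [hB1e]; funext i; unfold flipOn; by_cases h1 : i ∈ Fs <;> by_cases h2 : i ∈ F1 <;> simp [h1, h2]
  -- weights mod p
  have wmod : ∀ (y : Fin n → Bool) (F : Finset (Fin n)), (∀ i ∈ F, y i = false) → F.card = p → wt (flipOn F y) % p = wt y % p := by
    intro y F hy hc
    rw [Coset21.wt_eq_wtPrefix, Coset21.wt_eq_wtPrefix, wtPrefix_flipOn_false F y hy n,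
      Finset.filter_true_of_mem (fun i _ => i.isLt), hc, Nat.add_mod_right]
  have cF1 : F1.card = p := by
    have := card_seg_filter_of_ge (n := n) (lo := a + C + v) (len := p) (r := n) (by omega) (by omega)
    rw [Finset.filter_true_of_mem (fun i _ => i.isLt)] at this; rw [hF1]; exact this
  have cFs : Fs.card = p := by
    have := card_seg_filter_of_ge (n := n) (lo := b) (len := p) (r := n) (by omega) (by omega)
    rw [Finset.filter_true_of_mem (fun i _ => i.isLt)] at this; rw [hFs]; exact this
  -- split the registers at t = b - R
  have split : ∀ y : Fin n → Bool, reg S y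
      = (∑ g ∈ univ.filter (fun g : Fin (n + 1) => g.val < b - R), term S y g)
        + ∑ g ∈ univ.filter (fun g : Fin (n + 1) => ¬ g.val < b - R), term S y g := by
    intro y; unfold reg; rw [Finset.sum_filter_add_sum_filter_not]
  -- LEFT: the far segment is invisible
  have left : ∀ (y : Fin n → Bool), (∀ i ∈ Fs, y i = false) → (∀ i : Fin n, ¬ (a ≤ i.val ∧ i.val < a + L) → y i = u i) →
      ∀ g : Fin (n + 1), g.val < b - R → term S (flipOn Fs y) g = term S y g := by
    intro y hy hyo g hg
    apply term_congr S g
    · rcases hLB g with hloc | hbl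
      · apply hloc
        · intro i h1 h2
          apply flipOn_of_not_mem
          intro hi; rw [hFs, mem_seg] at hi; omega
        · exact wmod y Fs hy cFs
      · apply hbl
        · intro i hi
          apply flipOn_of_not_mem
          intro hi'; rw [hFs, mem_seg] at hi'; omega
        · exact wmod y Fs hy cFs
    · rw [wtPrefix_flipOn_false Fs y hy g.val, hFs, card_seg_filter_of_le (by omega), add_zero]
  -- RIGHT: adding the segment F1 below relabels by ζ^p
  have right : ∀ (y : Fin n → Bool), (∀ i ∈ F1, y i = false) →
      ∀ g : Fin (n + 1), ¬ g.val < b - R → term S (flipOn F1 y) g = rotZ ((p : ℕ) : ZMod 3) (term S y g) := by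
    intro y hy g hg
    apply term_shift S g p
    · rcases hLB g with hloc | hbl
      · apply hloc
        · intro i h1 h2
          apply flipOn_of_not_mem
          intro hi; rw [hF1, mem_seg] at hi; omega
        · exact wmod y F1 hy cF1
      · apply hbl
        · intro i hi
          apply flipOn_of_not_mem
          intro hi'; rw [hF1, mem_seg] at hi'; omega
        · exact wmod y F1 hy cF1
    · rw [wtPrefix_flipOn_false F1 y hy g.val, hF1, card_seg_filter_of_ge (by omega) (by omega)]
  -- assemble
  have hB0o : ∀ i : Fin n, ¬ (a ≤ i.val ∧ i.val < a + L) → B0 i = u i := fun i hi => fillBlock_outside u i hi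
  have hB1o : ∀ i : Fin n, ¬ (a ≤ i.val ∧ i.val < a + L) → B1 i = u i := fun i hi => fillBlock_outside u i hi
  have L0 : (∑ g ∈ univ.filter (fun g : Fin (n + 1) => g.val < b - R), term S (flipOn Fs B0) g)
      = ∑ g ∈ univ.filter (fun g : Fin (n + 1) => g.val < b - R), term S B0 g :=
    Finset.sum_congr rfl fun g hg => left B0 zB0Fs hB0o g (Finset.mem_filter.mp hg).2
  have L1 : (∑ g ∈ univ.filter (fun g : Fin (n + 1) => g.val < b - R), term S (flipOn Fs B1) g)
      = ∑ g ∈ univ.filter (fun g : Fin (n + 1) => g.val < b - R), term S B1 g :=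
    Finset.sum_congr rfl fun g hg => left B1 zB1Fs hB1o g (Finset.mem_filter.mp hg).2
  have R1 : (∑ g ∈ univ.filter (fun g : Fin (n + 1) => ¬ g.val < b - R), term S B1 g)
      = rotZ ((p : ℕ) : ZMod 3) (∑ g ∈ univ.filter (fun g : Fin (n + 1) => ¬ g.val < b - R), term S B0 g) := by
    rw [rotZ_sum, hB1e]
    exact Finset.sum_congr rfl fun g hg => right B0 zB0F1 g (Finset.mem_filter.mp hg).2
  have R2 : (∑ g ∈ univ.filter (fun g : Fin (n + 1) => ¬ g.val < b - R), term S (flipOn Fs B1) g)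
      = rotZ ((p : ℕ) : ZMod 3) (∑ g ∈ univ.filter (fun g : Fin (n + 1) => ¬ g.val < b - R), term S (flipOn Fs B0) g) := by
    rw [rotZ_sum, hT1e]
    exact Finset.sum_congr rfl fun g hg => right (flipOn Fs B0) zT0F1 g (Finset.mem_filter.mp hg).2
  rw [split (flipOn Fs B1), split B1, split (flipOn Fs B0), split B0, L0, L1, R1, R2]
  -- abelian-group bookkeeping in F4 (char 2)
  set X := ∑ g ∈ univ.filter (fun g : Fin (n + 1) => g.val < b - R), term S B1 g
  set Y := ∑ g ∈ univ.filter (fun g : Fin (n + 1) => g.val < b - R), term S B0 g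
  set P := ∑ g ∈ univ.filter (fun g : Fin (n + 1) => ¬ g.val < b - R), term S (flipOn Fs B0) g
  set Q := ∑ g ∈ univ.filter (fun g : Fin (n + 1) => ¬ g.val < b - R), term S B0 g
  rw [rotZ_map_add, rotZ_map_add, rotZ_map_add]
  have key : ∀ (x y rp rq ry : F4), x + rp + (x + rq) = (ry + rp + (ry + rq)) := by decide
  exact key X Y _ _ _

end Increment

/-! ### §4 The increment law, the three-weights law and the period `3p` -/

/-- the weight of a block input grows by the added ones. -/
theorem wt_fillBlock_add (u : Fin n → Bool) {a L C v q : ℕ} (h : C + v + q ≤ L) (hn : a + L ≤ n) :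
    wt (fillBlock u a L C (v + q)) = wt (fillBlock u a L C v) + q := by
  have z : ∀ i ∈ (seg (a + C + v) q : Finset (Fin n)), fillBlock u a L C v i = false := fun i hi => by
    rw [mem_seg] at hi; exact fillBlock_false u i (by omega) (by omega)
  rw [fillBlock_add u a L C v q h, Coset21.wt_eq_wtPrefix, Coset21.wt_eq_wtPrefix, wtPrefix_flipOn_false _ _ z n,
    card_seg_filter_of_ge (by omega) (by omega)]

/-- **THE INCREMENT LAW**: on a degenerate interval with every cut R-local or block-blind, the registers of the block inputs of weights
`v, v+p, v+2p` satisfy `Ŵ(v+2p) + Ŵ(v+p) = ζ^p · (Ŵ(v+p) + Ŵ(v))`. -/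
theorem increment_law (hp : 1 ≤ p) (hp3 : p % 3 ≠ 0) (c : ℕ) (S : ThreeStep p n) {a L R C v : ℕ}
    (hLB : LocalOrBlind S a L R) (hdeg : ∀ k, a ≤ k → k < a + L → Degenerate c S k)
    (hn : a + L + 2 * R + 4 * (2 * p - 1) ≤ n) (hL : C + v + 3 * p + 2 * R ≤ L) (u : Fin n → Bool) :
    reg S (fillBlock u a L C (v + 2 * p)) + reg S (fillBlock u a L C (v + p))
      = rotZ ((p : ℕ) : ZMod 3) (reg S (fillBlock u a L C (v + p)) + reg S (fillBlock u a L C v)) := by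
  have hLn : a + L ≤ n := by omega
  set b := a + C + v + p + 2 * R with hb
  set B0 := fillBlock u a L C v with hB0
  set B1 := fillBlock u a L C (v + p) with hB1
  set B2 := fillBlock u a L C (v + 2 * p) with hB2
  set Fs : Finset (Fin n) := seg b p with hFs
  -- symmetry: the register only sees the block weight
  have hsym : ∀ x x' : Fin n → Bool, (∀ i : Fin n, i.val < a ∨ a + L ≤ i.val → x i = x' i) →
      cnt x a (a + L) = cnt x' a (a + L) → reg S x = reg S x' :=
    swap_connect (reg S) a (a + L) (fun k h1 h2 y => reg_cornerFlip hp hp3 c S hLB hdeg hn (by omega) h2 y)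
  have hB1e : B1 = flipOn (seg (a + C + v) p) B0 := fillBlock_add u a L C v p (by omega)
  have hB2e : B2 = flipOn (seg (a + C + v + p) p) B1 := by
    rw [hB2, hB1, show v + 2 * p = (v + p) + p by ring, show a + C + v + p = a + C + (v + p) by ring]
    exact fillBlock_add u a L C (v + p) p (by omega)
  have zB0 : ∀ i ∈ (seg (a + C + v) p : Finset (Fin n)), B0 i = false := fun i hi => by
    rw [mem_seg] at hi; exact fillBlock_false u i (by omega) (by omega)
  have zB1 : ∀ i ∈ (seg (a + C + v + p) p : Finset (Fin n)), B1 i = false := fun i hi => by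
    rw [mem_seg] at hi; exact fillBlock_false u i (by omega) (by omega)
  have zB0s : ∀ i ∈ Fs, B0 i = false := fun i hi => by
    rw [hFs, mem_seg] at hi; exact fillBlock_false u i (by omega) (by omega)
  have zB1s : ∀ i ∈ Fs, B1 i = false := fun i hi => by
    rw [hFs, mem_seg] at hi; exact fillBlock_false u i (by omega) (by omega)
  -- agreement outside the block region
  have outF : ∀ (y : Fin n → Bool) (lo len : ℕ), a ≤ lo → lo + len ≤ a + L →
      ∀ i : Fin n, i.val < a ∨ a + L ≤ i.val → flipOn (seg lo len) y i = y i := by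
    intro y lo len h1 h2 i hi
    apply flipOn_of_not_mem; intro h; rw [mem_seg] at h; omega
  -- the two-block inputs have the registers of the one-block inputs of the same weight
  have e1 : reg S B1 = reg S (flipOn Fs B0) := by
    apply hsym
    · intro i hi; rw [hB1e, outF B0 _ _ (by omega) (by omega) i hi, outF B0 _ _ (by omega) (by omega) i hi]
    · rw [hB1e, cnt_flipOn_seg B0 (by omega) (by omega) hLn zB0, hFs, cnt_flipOn_seg B0 (by omega) (by omega) hLn zB0s]
  have e2 : reg S B2 = reg S (flipOn Fs B1) := by
    apply hsym
    · intro i hi; rw [hB2e, outF B1 _ _ (by omega) (by omega) i hi, outF B1 _ _ (by omega) (by omega) i hi]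
    · rw [hB2e, cnt_flipOn_seg B1 (by omega) (by omega) hLn zB1, hFs, cnt_flipOn_seg B1 (by omega) (by omega) hLn zB1s]
  have hinc := increment_homog S u hLB hL hLn
  rw [← hFs, ← hB0, ← hB1, ← e1, ← e2] at hinc
  exact hinc

/-- the final trace computation: registers `A₀, A₀ + D, A₀ + D + ζ^s D` against `Tr(ζ^{t₀ + ks} ·)` cannot all give `1`. -/
theorem not_three_ones (t₀ s : ZMod 3) (A₀ D : F4) (hs : s ≠ 0) :
    ¬ (evZ t₀ A₀ = 1 ∧ evZ (t₀ + s) (A₀ + D) = 1 ∧ evZ (t₀ + s + s) (A₀ + D + rotZ s D) = 1) := by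
  revert t₀ s A₀ D; decide

/-- the same with the increment relation as hypothesis. -/
theorem not_three_ones' (t₀ s : ZMod 3) (A₀ A₁ A₂ : F4) (hs : s ≠ 0) (h : A₂ + A₁ = rotZ s (A₁ + A₀)) :
    ¬ (evZ t₀ A₀ = 1 ∧ evZ (t₀ + s) A₁ = 1 ∧ evZ (t₀ + s + s) A₂ = 1) := by
  have e1 : A₁ = A₀ + (A₁ + A₀) := by
    have : ∀ x y : F4, x = y + (x + y) := by decide
    exact this _ _
  have e2 : A₂ = A₀ + (A₁ + A₀) + rotZ s (A₁ + A₀) := by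
    have : ∀ (x y z r : F4), z + y = r → z = x + (y + x) + r := by decide
    exact this A₀ A₁ A₂ _ h
  rintro ⟨h0, h1, h2⟩
  rw [e2] at h2
  rw [e1] at h1
  exact not_three_ones t₀ s A₀ (A₁ + A₀) hs ⟨h0, h1, h2⟩

/-- **THE THREE-WEIGHTS LAW (module U-d).** On a degenerate interval `[a, a+L)` where every cut is R-local or block-blind, for any
outside bits `u`, offset `C` and weight `v` with room, the block inputs of weights `v`, `v + p`, `v + 2p` do not all win. -/
theorem threeWeights_law (hp : 1 ≤ p) (hp3 : p % 3 ≠ 0) (c : ℕ) (S : ThreeStep p n) {a L R C v : ℕ}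
    (hLB : LocalOrBlind S a L R) (hdeg : ∀ k, a ≤ k → k < a + L → Degenerate c S k)
    (hn : a + L + 2 * R + 4 * (2 * p - 1) ≤ n) (hL : C + v + 3 * p + 2 * R ≤ L) (u : Fin n → Bool) :
    ¬ (ringWinU c S.y (fillBlock u a L C v) = true ∧ ringWinU c S.y (fillBlock u a L C (v + p)) = true ∧
       ringWinU c S.y (fillBlock u a L C (v + 2 * p)) = true) := by
  have hLn : a + L ≤ n := by omega
  have hinc := increment_law hp hp3 c S hLB hdeg hn hL u
  have w1 : wt (fillBlock u a L C (v + p)) = wt (fillBlock u a L C v) + p := wt_fillBlock_add u (by omega) hLn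
  have w2 : wt (fillBlock u a L C (v + 2 * p)) = wt (fillBlock u a L C v) + p + p := by
    rw [show v + 2 * p = v + (p + p) by ring, wt_fillBlock_add u (by omega) hLn]; ring
  rw [ringWinU_iff_ev, ringWinU_iff_ev, ringWinU_iff_ev, w2, w1]
  have t1 : ((c + (wt (fillBlock u a L C v) + p) : ℕ) : ZMod 3) = ((c + wt (fillBlock u a L C v) : ℕ) : ZMod 3) + (p : ℕ) := by
    push_cast; ring
  have t2 : ((c + (wt (fillBlock u a L C v) + p + p) : ℕ) : ZMod 3)
      = ((c + wt (fillBlock u a L C v) : ℕ) : ZMod 3) + (p : ℕ) + (p : ℕ) := by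
    push_cast; ring
  rw [t1, t2]
  exact not_three_ones' _ _ _ _ _ (cast_p_ne_zero hp3) hinc

/-- **PERIOD `3p`**: the register of the block input is `3p`-periodic in the block weight (`1 + ζ^p + ζ^{2p} = 0`). -/
theorem reg_fillBlock_period (hp : 1 ≤ p) (hp3 : p % 3 ≠ 0) (c : ℕ) (S : ThreeStep p n) {a L R C v : ℕ}
    (hLB : LocalOrBlind S a L R) (hdeg : ∀ k, a ≤ k → k < a + L → Degenerate c S k)
    (hn : a + L + 2 * R + 4 * (2 * p - 1) ≤ n) (hL : C + v + 4 * p + 2 * R ≤ L) (u : Fin n → Bool) :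
    reg S (fillBlock u a L C (v + 3 * p)) = reg S (fillBlock u a L C v) := by
  have h1 := increment_law hp hp3 c S hLB hdeg hn (C := C) (v := v) (by omega) u
  have h2 := increment_law hp hp3 c S hLB hdeg hn (C := C) (v := v + p) (by omega) u
  rw [show v + p + 2 * p = v + 3 * p by ring, show v + p + p = v + 2 * p by ring, h1, ← rotZ_add] at h2
  -- A₃ + A₂ = ζ^{2p} D, A₂ + A₁ = ζ^p D with D = A₁ + A₀, and D + ζ^p D + ζ^{2p} D = 0
  have key : ∀ (s : ZMod 3) (A₀ A₁ A₂ A₃ : F4), s ≠ 0 → A₂ + A₁ = rotZ s (A₁ + A₀) → A₃ + A₂ = rotZ (s + s) (A₁ + A₀) →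
      A₃ = A₀ := by
    decide
  exact key _ _ _ _ _ (cast_p_ne_zero hp3) h1 h2

/-- Hence **WIN is `3p`-periodic in the block weight** on a degenerate interval (room `C + v + 4p + 2R ≤ L`). -/
theorem win_fillBlock_period (hp : 1 ≤ p) (hp3 : p % 3 ≠ 0) (c : ℕ) (S : ThreeStep p n) {a L R C v : ℕ}
    (hLB : LocalOrBlind S a L R) (hdeg : ∀ k, a ≤ k → k < a + L → Degenerate c S k)
    (hn : a + L + 2 * R + 4 * (2 * p - 1) ≤ n) (hL : C + v + 4 * p + 2 * R ≤ L) (u : Fin n → Bool) :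
    ringWinU c S.y (fillBlock u a L C (v + 3 * p)) = ringWinU c S.y (fillBlock u a L C v) := by
  have hr := reg_fillBlock_period hp hp3 c S hLB hdeg hn hL u
  have hw : wt (fillBlock u a L C (v + 3 * p)) = wt (fillBlock u a L C v) + 3 * p := wt_fillBlock_add u (by omega) (by omega)
  have ht : ((c + wt (fillBlock u a L C (v + 3 * p)) : ℕ) : ZMod 3) = ((c + wt (fillBlock u a L C v) : ℕ) : ZMod 3) := by
    rw [hw]
    push_cast
    have : (3 : ZMod 3) = 0 := by decide
    rw [this, zero_mul, add_zero]
  rw [Bool.eq_iff_iff, ringWinU_iff_ev, ringWinU_iff_ev, hr, ht]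

end RungU

end Summit.QuantumAdvantage.AdviceFreeQNC0.LocalEngine
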